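import Summits.QuantumFields.YangMills.Theorems.UnitScaleTiltFluctuationComparisonRegPrGlobalSlackLegCfgDistNaturalRows
import Summits.QuantumFields.YangMills.Theorems.UnitScaleTiltFluctuationComparisonRegPrGlobalSlackKernelLegGeometry
import Summits.QuantumFields.YangMills.Theorems.UnitScaleTiltFluctuationComparisonRegPrGlobalSlackKernelLegCfgFineScales
import Summits.QuantumFields.YangMills.Theorems.UnitScaleTiltFluctuationComparisonRegPrOneTower
import HarnessLib

/-!
# `UnitScaleTiltFluctuationComparisonRegPrGlobalSlackKernelLegAnchorCoherent` — A RUN-COHERENT AXIAL ANCHOR FOR THE NATURAL CONFIGURATION FAMILY; THE (27) LOOP VARIABLE IS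
# TRANSPORTED BY THE LEVEL IDENTIFICATION OF THE TWO RUNS; THE TWO-RUN ROW (BC) OF THE COHERENT NATURAL FAMILY SPLITS INTO THE NEW-LEVEL ROW OF THE BIRTH CONFIGURATIONS PLUS A FINE
# COMPARISON (crux `FluctuationComparisonRegPrIntL`, stmt-QuantumFields-20520, skeleton v5kD, STUB 3⁗χ(v4); cell `pub/ym-inputs`, seat ym-inputs-p12 gen 6 = INPUT-LIST I-11 row
# `CfgDistCauchyΦ`; count-neutral helper, def-free, registry untouched)

WHY.  The natural configuration family `B♮ᴿ` of `…LegCfgDistNaturalT3` / `…LegCfgDistNaturalRows(Door)` (print's (43) loop variables below the new level, the record's `Bcfg` on it) anchors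
the (27) contour at `y(Y) := (anchors_nonempty K b Y).choose`.  The two-run rows (BC) `CfgDistCauchyΦ D B♮ᴿ …` (two-run door `…NaturalRowsTwoRunDoor`) and (R5) `CfgRefOwnΦ D B♮ᴿ BR …`
(`…NaturalRowsDoor`) compare `B♮ᴿ (K+1) (K+1−n) (j+1) (refineSet Y) · (matchBond c)` with `B♮ᴿ K (K−n) j Y · c`; the run-`K+1` anchor is `(anchors_nonempty (K+1) (j+1) (refineSet Y)).choose
: Site (F.P (K+1)) (j+1)`, an INDEPENDENT choice in a different type.  The anchor SETS are matched (`anchors_refineSet`: `anchors (K+1) (j+1) (refineSet Y) = liftSite '' anchors K j Y`), the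
chosen anchors are not — nothing relates `Classical.choice` on the two subtypes — and below the new level the listed domains are single blocks (`exists_blockSet_of_mem_canonLocCore`) whose
anchor set, the level-`j` shadow, has `L³ ≥ 27` points.  The (27) variable DEPENDS on the anchor at the size order of (44): for one level-`j` field, anchors `y`, `y″ = y + e₁` of one block
and the bond `c = ⟨(y₁, x₂, x₃), e₂⟩`, the comb contour from `y` retraces (`B27T · y c = 0`) while from `y″` it bounds exactly one (1,2)-plaquette `p` (`‖B27T · y″ c‖ = ‖log U(∂p)‖`); so wherever
the two chosen anchors are not lifts of each other the (BC) difference at `c` is of the order `θ(n)·x_j²` of (44), short of the row's `C_B(1 + d(c))θ(n)x_j²·(L^{−(1+j)})^a` by the unbounded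
factor `L^{a(1+j)}`: (BC)[`B♮ᴿ`] / (R5)[`B♮ᴿ`] are not dischargeable AS TYPED at non-flat backgrounds.  Every ONE-run row of `B♮ᴿ` ((N), (S)/(44), (R4), (M1), (43)) is unaffected (any anchor in
the block is print's convention «y the centre of □», p.263).  THE REPAIR is a run-coherent anchor: one exists (§1), and with it the (B′) intertwining of `…KernelLegCfgFineScales` §2 below the
new level is an IDENTITY (§2–§3), so the row splits as gen 5 located it («(BC)♮ ⇐ new-level coherence + (Fine_b)»).

WHAT THIS FILE PROVES (def-free; the coherent family `B♮ᶜ[q, p₁, sel]` = `B♮ᴿ` with `sel K b Y` for `(anchors_nonempty K b Y).choose`, written INLINE).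
* §1 ★ **`exists_anchorSel_coherent`**: `∃ sel, (∀ K b Y, sel K b Y ∈ anchors K b Y) ∧ ∀ K b Y, sel (K+1) (b+1) (refineSet F K Y) = liftSite F K b (sel K b Y)` — the anchor of least label
  code (Cantor pairing of the canonical representatives: `labelCode_injective`, `labelCode_liftSite`; `anchors_refineSet`).  A consumer takes `sel := Classical.choose (exists_anchorSel_coherent F)`
  ONCE — one global choice of the whole selector — and every row of `…NaturalRows(Door)` ports verbatim (their proofs use only the membership `choose_spec`).
* §2 transport of (27) along the level identification (values in any group / Banach algebra): `rel_siteShift`, `contourT_siteShift`, `holT_fieldShift_group` (the tree's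
  `AvgCurvGrad.holT_fieldShift` without its `GaugeGroup` instance), **`B27T_fieldShift`**, the two-run forms **`B27T_liftSite_matchBond`**, `l1_rel_liftSite_matchBond`, `fieldShift_iter_succ`
  (`LogComparisonOneTower.fieldShift_iter_one_add` at index `j + 1`), ★ **`B27T_iter_succ_liftSite_matchBond`**: run `K+1`'s (27) variable of the `(j+1)`-fold average of `U′` at
  `(liftSite y, matchBond c)` = run `K`'s (27) variable of the `j`-fold average of `e₀(avg₀ U′)` at `(y, c)`.
* §3 **`cfgDistCauchyΦ_of_fineComparison_scale_split`** — `cfgDistCauchyΦ_of_fineComparison_scale` with the row's inequality AT the new chart level `j + 1 = K − n` taken verbatim (display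
  (New)) and (B), (B′), (Lip♮), (Fine_b) asked only BELOW it; **`naturalCoherent_apply_of_ne`** ((B) below the new level, `dif_neg`); ★ **`naturalCoherent_succ_apply_of_lt`** ((B′) below the
  new level IS an identity for a coherent anchor); ★★ **`cfgDistCauchyΦ_naturalCoherent_of_newLevel_of_fine`**: `CfgDistCauchyΦ D B♮ᶜ dist 𝔠.b₀ p₁ a (max C_N (L_Φ·C_f))` ⇐ coherence of
  `sel` + (New) + (Lip♮) for the chart-level map `Φ♮` between run `K`'s fine minimiser and run `K+1`'s once-averaged one + (Fine_b) — for ANY rows record `q`, datum `D`, leg distance `dist`.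
HONEST FRAMING.  Lattice bookkeeping on accepted tree lemmas plus one located defect of a displayed row; (New) (the pinned record's two-run coherence of `Bcfg`) and (Fine_b) (two-cut-off
consistency of the constrained minimisers, UNPRINTED for non-abelian d = 3, INPUT-LIST §5 item 3) are displayed, not claimed; (Lip♮) is the [Balaban1985Averaging] Prop. 6 (164) shape met
gauge-invariantly by `…KernelLegCfgFineScalesLocal` §4.  Whether the (α)-record / the two-run door adopt `B♮ᶜ` is their call.  Nothing of [Balaban1985UV3] / [Balaban1985Averaging] /
[Balaban1987RG1] / [King1986] is asserted; no summit / rung / gap claim (YM₃ on T³ is ladder rung R3, not the Clay problem).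

References: T. Bałaban, CMP 102 (1985) 255–275 [Balaban1985UV3] ((27)–(28) p.263, (43)–(45) pp.266–267); CMP 98 (1985) 17–51 [Balaban1985Averaging] ((9) p.18, Prop. 6 (164) p.43);
CMP 109 (1987) 249–301 [Balaban1987RG1] ((0.1)–(0.3) pp.251–252, (0.11) p.253); C. King, CMP 102 (1986) 649–677 [King1986] (Prop. 3.8 (3.71) p.664, Prop. 3.9 (3.73)–(3.74) p.665).
-/

set_option autoImplicit false

noncomputable section

open scoped Matrix.Norms.L2Operator
open Literature.MathematicalPhysics.QuantumFieldTheory.Balaban1983to89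
open Literature.MathematicalPhysics.QuantumFieldTheory.Balaban1983to89.T3ContinuumYM3Torus
open Literature.MathematicalPhysics.QuantumFieldTheory.Balaban1983to89.T3UnitLawDensityEML (ℰp)
open Literature.MathematicalPhysics.QuantumFieldTheory.Balaban1983to89.T3UnitScaleTilt (θBal)
open Literature.MathematicalPhysics.QuantumFieldTheory.Balaban1983to89.T3LevelShift
open Literature.MathematicalPhysics.QuantumFieldTheory.Balaban1983to89.T3AlphaInputsAC (AlphaDataT3)
open Literature.MathematicalPhysics.QuantumFieldTheory.Balaban1983to89.T3AlphaPolymerSocket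
open Literature.MathematicalPhysics.QuantumFieldTheory.Balaban1983to89.B10Eq27TorusAxialLog
open Literature.MathematicalPhysics.QuantumFieldTheory.Balaban1983to89.B7Prop1Explicit (l1 Letter)
open Literature.MathematicalPhysics.QuantumFieldTheory.Balaban1985CMP102
open Literature.MathematicalPhysics.QuantumFieldTheory.Balaban1985CMP102.Setting
open Summit.QuantumFields.Balaban3D.Carriers
open Summit.QuantumFields.Balaban3D.Proofs.Primitives
open Summit.QuantumFields.Balaban3D.Proofs.GroupModelLieC (vecE lieC)
open Summit.QuantumFields.YangMills.Theorems
open Summit.QuantumFields.YangMills.Theorems.GlobalSlackKernelMatching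
open Summit.QuantumFields.YangMills.Theorems.GlobalSlackCanonicalPolymers

namespace Summit.QuantumFields.YangMills.Theorems.GlobalSlackKernelLeg

variable {F : T3Family}

/-! ## §1 A run-coherent anchor selector -/

section Anchors

/-- The label code of a level-`b` site — the Cantor pairing of its three canonical representatives — is injective. [folklore] -/
theorem labelCode_injective (K b : ℕ) :
    Function.Injective (fun z : Site (F.P K) b => Nat.pair (z 0).val (Nat.pair (z 1).val (z 2).val)) := by
  intro z z' h
  obtain ⟨h0, h1, h2⟩ := by simpa only [Nat.pair_eq_pair] using h
  funext ν
  fin_cases ν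
  exacts [ZMod.val_injective _ h0, ZMod.val_injective _ h1, ZMod.val_injective _ h2]

/-- The label code is invariant under the level identification `liftSite` of the two runs (equal labels, `val_liftSite`). [cite: Balaban1987RG1, (0.1) p.251] -/
theorem labelCode_liftSite (K b : ℕ) (y : Site (F.P K) b) :
    Nat.pair ((liftSite F K b y) 0).val (Nat.pair ((liftSite F K b y) 1).val ((liftSite F K b y) 2).val) =
      Nat.pair (y 0).val (Nat.pair (y 1).val (y 2).val) := by
  simp only [val_liftSite]; rfl

/-- ★ **A RUN-COHERENT ANCHOR SELECTOR EXISTS**: a choice `sel K b Y ∈ anchors K b Y` of ONE anchor per (run, chart index, domain) with `sel (K+1) (b+1) (refineSet Y) =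
liftSite (sel K b Y)` — the anchor of least label code (`anchors_refineSet`: the anchor SETS are matched; the code is `liftSite`-invariant and injective); what a two-run row of the
natural family needs and an independent `Classical.choose` per run does not give. [cite: Balaban1987RG1, (0.1) p.251; Balaban1985UV3, (43) p.266] -/
theorem exists_anchorSel_coherent (F : T3Family) :
    ∃ sel : (K b : ℕ) → Set (Site (F.P K) 0) → Site (F.P K) b,
      (∀ (K b : ℕ) (Y : Set (Site (F.P K) 0)), sel K b Y ∈ anchors K b Y) ∧
      ∀ (K b : ℕ) (Y : Set (Site (F.P K) 0)), sel (K + 1) (b + 1) (refineSet F K Y) = liftSite F K b (sel K b Y) := by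
  classical
  have hex : ∀ (K b : ℕ) (Y : Set (Site (F.P K) 0)), ∃ z ∈ anchors K b Y, ∀ z' ∈ anchors K b Y,
      Nat.pair (z 0).val (Nat.pair (z 1).val (z 2).val) ≤ Nat.pair (z' 0).val (Nat.pair (z' 1).val (z' 2).val) :=
    fun K b Y => Finset.exists_min_image (anchors K b Y) (fun z => Nat.pair (z 0).val (Nat.pair (z 1).val (z 2).val)) (anchors_nonempty K b Y)
  refine ⟨fun K b Y => (hex K b Y).choose, fun K b Y => (hex K b Y).choose_spec.1, fun K b Y => ?_⟩
  show (hex (K + 1) (b + 1) (refineSet F K Y)).choose = liftSite F K b (hex K b Y).choose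
  obtain ⟨h₁mem, h₁min⟩ := (hex (K + 1) (b + 1) (refineSet F K Y)).choose_spec
  obtain ⟨h₀mem, h₀min⟩ := (hex K b Y).choose_spec
  generalize (hex (K + 1) (b + 1) (refineSet F K Y)).choose = z₁ at h₁mem h₁min ⊢
  generalize (hex K b Y).choose = z₀ at h₀mem h₀min ⊢
  have hz₀' : liftSite F K b z₀ ∈ anchors (K + 1) (b + 1) (refineSet F K Y) := by
    rw [anchors_refineSet]; exact Finset.mem_image_of_mem _ h₀mem
  obtain ⟨w, hw, hwz⟩ : ∃ w ∈ anchors K b Y, liftSite F K b w = z₁ := by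
    rw [anchors_refineSet, Finset.mem_image] at h₁mem
    exact h₁mem
  apply labelCode_injective (K + 1) (b + 1)
  dsimp only
  apply le_antisymm
  · exact h₁min _ hz₀'
  · rw [labelCode_liftSite, ← hwz, labelCode_liftSite]
    exact h₀min w hw

end Anchors

/-! ## §2 Transport of the (27) loop variable along the level identification -/

section Transport

variable {m K j m' K' j' : ℕ}

/-- Relative positions are preserved by the level identification (`valMinAbs_coordEquiv`). [cite: Balaban1987RG1, (0.1) p.251] -/
theorem rel_siteShift (h : (F.PP m K).sitesPerDir j = (F.PP m' K').sitesPerDir j') (y x : Site (F.PP m K) j) :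
    rel (siteShift h y) (siteShift h x) = rel y x := by
  funext ν
  rw [rel_apply, rel_apply, siteShift_apply, siteShift_apply, ← map_sub, valMinAbs_coordEquiv]

/-- Hence the (27) contour word `Γ_{y,c₋} ∪ c ∪ Γ_{c₊,y}` is the same word from the identified anchor and bond. [cite: Balaban1985UV3, (27) p.263] -/
theorem contourT_siteShift (h : (F.PP m K).sitesPerDir j = (F.PP m' K').sitesPerDir j') (y : Site (F.PP m K) j) (c : PBond (F.PP m K) j) :
    contourT (siteShift h y) (bondShift h c) = contourT y c := by
  unfold contourT; rw [bondShift_src, bondShift_dir, rel_siteShift]; rfl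

variable {G : Type*} [Group G]

/-- Transports of `fieldShift h V` are transports of `V` from the identified site, values in ANY group. [cite: Balaban1987RG1, (0.1) p.251; Balaban1985Averaging, (9) p.18] -/
theorem holT_fieldShift_group (h : (F.PP m K).sitesPerDir j = (F.PP m' K').sitesPerDir j') (V : GaugeField (F.PP m' K') j' G) :
    ∀ (x : Site (F.PP m K) j) (w : List (Letter 3)), holT (fieldShift h V) x w = holT V (siteShift h x) w
  | _, [] => rfl
  | x, (μ, true) :: w => by
    show V (bondShift h ⟨x, μ⟩) * holT (fieldShift h V) (x.shift μ) w = V ⟨siteShift h x, μ⟩ * holT V ((siteShift h x).shift μ) w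
    rw [holT_fieldShift_group h V (x.shift μ) w, siteShift_shift]; rfl
  | x, (μ, false) :: w => by
    show (V ⟨siteShift h (x.unshift μ), μ⟩)⁻¹ * holT (fieldShift h V) (x.unshift μ) w =
      (V ⟨(siteShift h x).unshift μ, μ⟩)⁻¹ * holT V ((siteShift h x).unshift μ) w
    rw [holT_fieldShift_group h V (x.unshift μ) w, siteShift_unshift]

variable {𝔸 : Type*} [NormedRing 𝔸] [NormedAlgebra ℂ 𝔸]

/-- **(27) IS TRANSPORTED BY THE LEVEL IDENTIFICATION**: `B27T (fieldShift h V) y c = B27T V (siteShift h y) (bondShift h c)`. [cite: Balaban1985UV3, (27) p.263; Balaban1987RG1, (0.1) p.251] -/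
theorem B27T_fieldShift (h : (F.PP m K).sitesPerDir j = (F.PP m' K').sitesPerDir j') (V : GaugeField (F.PP m' K') j' 𝔸ˣ)
    (y : Site (F.PP m K) j) (c : PBond (F.PP m K) j) :
    B27T (fieldShift h V) y c = B27T V (siteShift h y) (bondShift h c) := by
  rw [B27T_eq, B27T_eq, holT_fieldShift_group, contourT_siteShift]

/-- **TWO-RUN FORM**: run `K+1`'s (27) variable at the LIFTED anchor and MATCHED bond = run `K`'s of the field read on run `K`'s level `b`. [cite: Balaban1985UV3, (27) p.263] -/
theorem B27T_liftSite_matchBond (K b : ℕ) (V' : GaugeField (F.P (K + 1)) (b + 1) 𝔸ˣ) (y : Site (F.P K) b) (c : PBond (F.P K) b) :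
    B27T V' (liftSite F K b y) (matchBond F K b c) =
      B27T (fieldShift (F.sitesPerDir_eq (m := F.m) (K := K) (j := b) (m' := F.m) (K' := K + 1) (j' := b + 1) (by omega)) V') y c :=
  (B27T_fieldShift _ V' y c).symm

/-- `|c′₋ − y′|₁ = |c₋ − y|₁` for the matched bond and the lifted anchor. [cite: Balaban1985UV3, (28) p.263; Balaban1987RG1, (0.1) p.251] -/
theorem l1_rel_liftSite_matchBond (K b : ℕ) (y : Site (F.P K) b) (c : PBond (F.P K) b) :
    l1 (rel (liftSite F K b y) (matchBond F K b c).src) = l1 (rel y c.src) :=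
  congrArg l1 (rel_siteShift _ y c.src)

/-- Level bookkeeping: `fieldShift` along `n = n′` of a level-indexed family. [folklore] -/
theorem fieldShift_level_congr {H : Type*} {n n' : ℕ} (e : n = n') (h : (F.PP m K).sitesPerDir j = (F.PP m' K').sitesPerDir n)
    (h' : (F.PP m K).sitesPerDir j = (F.PP m' K').sitesPerDir n') (V : (k : ℕ) → GaugeField (F.PP m' K') k H) : fieldShift h (V n) = fieldShift h' (V n') := by
  subst e; rfl

variable {H : Type*} [GaugeGroup H]

/-- The `(j+1)`-fold average of run `K+1` read on run `K`'s level `j` is the `j`-fold average of `e₀(avg₀ U′)` (`fieldShift_iter_one_add`). [cite: Balaban1987RG1, (0.11) p.253] -/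
theorem fieldShift_iter_succ (K j : ℕ) (ℰ : LoopAverage H) (U' : GaugeField (F.P (K + 1)) 0 H) :
    fieldShift (F.sitesPerDir_eq (m := F.m) (K := K) (j := j) (m' := F.m) (K' := K + 1) (j' := j + 1) (by omega))
        (Averaging.iter (fun i => BlockAveraging.blockAvg (P := F.P (K + 1)) (j := i) ℰ) (j + 1) U') =
      Averaging.iter (fun i => BlockAveraging.blockAvg (P := F.P K) (j := i) ℰ) j
        (fieldShift (F.sitesPerDir_eq (m := F.m) (K := K) (j := 0) (m' := F.m) (K' := K + 1) (j' := 1) (by omega))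
          ((BlockAveraging.blockAvg (P := F.P (K + 1)) (j := 0) ℰ).avg U')) :=
  (fieldShift_level_congr (Nat.add_comm 1 j) _ _ fun k => Averaging.iter (fun i => BlockAveraging.blockAvg (P := F.P (K + 1)) (j := i) ℰ) k U').symm.trans
    (LogComparisonOneTower.fieldShift_iter_one_add F K ℰ j U')

/-- ★ **THE (B′) IDENTITY ENGINE**: run `K+1`'s (27) loop variable of the `(j+1)`-fold average of a fine field `U′`, at the lifted anchor and the matched bond, IS run `K`'s (27) loop
variable of the `j`-fold average of `e₀(avg₀ U′)` at `(y, c)` (`SU(2)` fields read in `M₂(ℂ)ˣ`). [cite: Balaban1985UV3, (27) p.263, (43) p.266; Balaban1987RG1, (0.1) p.251, (0.11) p.253] -/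
theorem B27T_iter_succ_liftSite_matchBond (K j : ℕ) (ℰ : LoopAverage (Matrix.specialUnitaryGroup (Fin 2) ℂ))
    (U' : GaugeField (F.P (K + 1)) 0 (Matrix.specialUnitaryGroup (Fin 2) ℂ)) (y : Site (F.P K) j) (c : PBond (F.P K) j) :
    B27T (unitsField (toUField (Averaging.iter (fun i => BlockAveraging.blockAvg (P := F.P (K + 1)) (j := i) ℰ) (j + 1) U')))
        (liftSite F K j y) (matchBond F K j c) =
      B27T (unitsField (toUField (Averaging.iter (fun i => BlockAveraging.blockAvg (P := F.P K) (j := i) ℰ) j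
        (fieldShift (F.sitesPerDir_eq (m := F.m) (K := K) (j := 0) (m' := F.m) (K' := K + 1) (j' := 1) (by omega))
          ((BlockAveraging.blockAvg (P := F.P (K + 1)) (j := 0) ℰ).avg U'))))) y c := by
  rw [B27T_liftSite_matchBond, ← fieldShift_iter_succ K j ℰ U']; rfl

end Transport

/-! ## §3 The row split at the new level; (B), (B′) below it are identities for the natural family with a coherent anchor -/

section Split

variable {𝕍 : Type} [NormedAddCommGroup 𝕍] [NormedSpace ℂ 𝕍] {γ : ℝ}

omit [NormedSpace ℂ 𝕍] in
/-- **THE I-11 ROW SPLIT AT THE NEW LEVEL** (variant of `cfgDistCauchyΦ_of_fineComparison_scale`, same seat): AT the new chart level `j + 1 = K − n` the row's inequality is taken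
VERBATIM as display (New) — there both runs' families are birth configurations and their two-run closeness is the pinned record's coherence — while BELOW it (`j + 1 < K − n`) the
row follows from (B), (B′), (Lip♮) `‖Φ(U) c − Φ(Ū) c‖ ≤ L_Φ·(1 + d(c))·L^j·δ(U, Ū)` and (Fine_b) `δ(U_K, Ū_{K+1}) ≤ C_f·θ(n)·((L^{K−n})⁻¹)^b` exactly as there (`2 ≤ b`, `a + 1 ≤ b`);
constant `max C_N (L_Φ·C_f)`. [cite: Balaban1985Averaging, Prop. 6 (164) p.43; King1986, Prop. 3.8 (3.71) p.664, Prop. 3.9 (3.73)-(3.74) p.665; Balaban1985UV3, (27) p.263, (44) p.267] -/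
theorem cfgDistCauchyΦ_of_fineComparison_scale_split {D : AlphaDataT3 F γ} {B : CfgFam 𝕍 F} {dist : LegDist F} {b₀ p₀ a b L_Φ C_f C_N : ℝ} (S : ℕ → Type)
    (U : (K k : ℕ) → GaugeField (F.P K) k (Matrix.specialUnitaryGroup (Fin 2) ℂ) → S K)
    (Ubar : (K k k' : ℕ) → GaugeField (F.P (K + 1)) k' (Matrix.specialUnitaryGroup (Fin 2) ℂ) → S K)
    (Φ : (K k b : ℕ) → Set (Site (F.P K) 0) → S K → (PBond (F.P K) b → 𝕍)) (δ : (K k : ℕ) → S K → S K → ℝ)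
    (hn : DistNonneg dist) (hL : 1 ≤ F.L) (hγ : 0 < γ) (hγ1 : γ ≤ 1) (hb : 0 < b₀) (hLΦ : 0 ≤ L_Φ) (hCf : 0 ≤ C_f) (hb2 : 2 ≤ b) (hab : a + 1 ≤ b)
    (hNew : ∀ (K n : ℕ) (h : n ≤ K), ∀ j : ℕ, j < K - n → j + 1 = K - n → ∀ V : GaugeField (F.P n) 0 (Matrix.specialUnitaryGroup (Fin 2) ℂ), PlaqSmall (θBal F.L γ b₀ p₀ n) V →
        ∀ Y ∈ D.Loc K (K - n) (D.triv K (K - n)) (1 + j), ∀ c : PBond (F.P K) j,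
          ‖B (K + 1) (K + 1 - n) (j + 1) (refineSet F K Y) (fieldShift (F.sitesPerDir_eq (m := F.m) (K := K + 1) (j := K + 1 - n) (m' := F.m) (K' := n) (j' := 0) (by omega)) V)
                (matchBond F K j c) -
              B K (K - n) j Y (fieldShift (F.sitesPerDir_eq (m := F.m) (K := K) (j := K - n) (m' := F.m) (K' := n) (j' := 0) (by omega)) V) c‖ ≤
            C_N * (1 + dist K j Y c) * θBal F.L γ b₀ p₀ n * (((F.L : ℝ) ^ (K - n - 1 - j))⁻¹) ^ 2 * (((F.L : ℝ) ^ (1 + j))⁻¹) ^ a)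
    (hB : ∀ (K n : ℕ) (h : n ≤ K), ∀ j : ℕ, j + 1 < K - n → ∀ V : GaugeField (F.P n) 0 (Matrix.specialUnitaryGroup (Fin 2) ℂ), PlaqSmall (θBal F.L γ b₀ p₀ n) V →
        ∀ Y ∈ D.Loc K (K - n) (D.triv K (K - n)) (1 + j),
          B K (K - n) j Y (fieldShift (F.sitesPerDir_eq (m := F.m) (K := K) (j := K - n) (m' := F.m) (K' := n) (j' := 0) (by omega)) V) = Φ K (K - n) j Y (U K (K - n) (fieldShift (F.sitesPerDir_eq (m := F.m) (K := K) (j := K - n) (m' := F.m) (K' := n) (j' := 0) (by omega)) V)))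
    (hB' : ∀ (K n : ℕ) (h : n ≤ K), ∀ j : ℕ, j + 1 < K - n → ∀ V : GaugeField (F.P n) 0 (Matrix.specialUnitaryGroup (Fin 2) ℂ), PlaqSmall (θBal F.L γ b₀ p₀ n) V →
        ∀ Y ∈ D.Loc K (K - n) (D.triv K (K - n)) (1 + j), ∀ c : PBond (F.P K) j,
          B (K + 1) (K + 1 - n) (j + 1) (refineSet F K Y) (fieldShift (F.sitesPerDir_eq (m := F.m) (K := K + 1) (j := K + 1 - n) (m' := F.m) (K' := n) (j' := 0) (by omega)) V) (matchBond F K j c) =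
            Φ K (K - n) j Y (Ubar K (K - n) (K + 1 - n) (fieldShift (F.sitesPerDir_eq (m := F.m) (K := K + 1) (j := K + 1 - n) (m' := F.m) (K' := n) (j' := 0) (by omega)) V)) c)
    (hLip : ∀ (K n : ℕ) (h : n ≤ K), ∀ j : ℕ, j + 1 < K - n → ∀ V : GaugeField (F.P n) 0 (Matrix.specialUnitaryGroup (Fin 2) ℂ), PlaqSmall (θBal F.L γ b₀ p₀ n) V →
        ∀ Y ∈ D.Loc K (K - n) (D.triv K (K - n)) (1 + j), ∀ c : PBond (F.P K) j,
          ‖Φ K (K - n) j Y (U K (K - n) (fieldShift (F.sitesPerDir_eq (m := F.m) (K := K) (j := K - n) (m' := F.m) (K' := n) (j' := 0) (by omega)) V)) c - Φ K (K - n) j Y (Ubar K (K - n) (K + 1 - n) (fieldShift (F.sitesPerDir_eq (m := F.m) (K := K + 1) (j := K + 1 - n) (m' := F.m) (K' := n) (j' := 0) (by omega)) V)) c‖ ≤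
            L_Φ * (1 + dist K j Y c) * (F.L : ℝ) ^ j *
              δ K (K - n) (U K (K - n) (fieldShift (F.sitesPerDir_eq (m := F.m) (K := K) (j := K - n) (m' := F.m) (K' := n) (j' := 0) (by omega)) V)) (Ubar K (K - n) (K + 1 - n) (fieldShift (F.sitesPerDir_eq (m := F.m) (K := K + 1) (j := K + 1 - n) (m' := F.m) (K' := n) (j' := 0) (by omega)) V)))
    (hFine : ∀ (K n : ℕ) (h : n ≤ K), 1 < K - n → ∀ V : GaugeField (F.P n) 0 (Matrix.specialUnitaryGroup (Fin 2) ℂ), PlaqSmall (θBal F.L γ b₀ p₀ n) V →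
        δ K (K - n) (U K (K - n) (fieldShift (F.sitesPerDir_eq (m := F.m) (K := K) (j := K - n) (m' := F.m) (K' := n) (j' := 0) (by omega)) V)) (Ubar K (K - n) (K + 1 - n) (fieldShift (F.sitesPerDir_eq (m := F.m) (K := K + 1) (j := K + 1 - n) (m' := F.m) (K' := n) (j' := 0) (by omega)) V)) ≤
          C_f * θBal F.L γ b₀ p₀ n * (((F.L : ℝ) ^ (K - n))⁻¹) ^ b) :
    CfgDistCauchyΦ D B dist b₀ p₀ a (max C_N (L_Φ * C_f)) := by
  intro K n hnK j hj V hV Y hY c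
  have hθ : 0 ≤ θBal F.L γ b₀ p₀ n := (T3MinimiserStabilityReduction.θBal_pos hL hγ hγ1 hb p₀ n).le
  have hd : 0 ≤ 1 + dist K j Y c := by linarith [hn K j Y c]
  have hfac : 0 ≤ (1 + dist K j Y c) * θBal F.L γ b₀ p₀ n * (((F.L : ℝ) ^ (K - n - 1 - j))⁻¹) ^ 2 * (((F.L : ℝ) ^ (1 + j))⁻¹) ^ a := by positivity
  rcases Nat.lt_or_ge (j + 1) (K - n) with hjo | hjn
  · rw [hB K n hnK j hjo V hV Y hY, hB' K n hnK j hjo V hV Y hY c, norm_sub_rev]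
    have h0 : 0 ≤ L_Φ * (1 + dist K j Y c) * (F.L : ℝ) ^ j := by positivity
    have h1 : 0 ≤ L_Φ * C_f * (1 + dist K j Y c) * θBal F.L γ b₀ p₀ n := mul_nonneg (mul_nonneg (mul_nonneg hLΦ hCf) hd) hθ
    calc _ ≤ L_Φ * (1 + dist K j Y c) * (F.L : ℝ) ^ j * (C_f * θBal F.L γ b₀ p₀ n * (((F.L : ℝ) ^ (K - n))⁻¹) ^ b) :=
          (hLip K n hnK j hjo V hV Y hY c).trans (mul_le_mul_of_nonneg_left (hFine K n hnK (by omega) V hV) h0)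
      _ = L_Φ * C_f * (1 + dist K j Y c) * θBal F.L γ b₀ p₀ n * ((F.L : ℝ) ^ j * (((F.L : ℝ) ^ (K - n))⁻¹) ^ b) := by ring
      _ ≤ L_Φ * C_f * (1 + dist K j Y c) * θBal F.L γ b₀ p₀ n * ((((F.L : ℝ) ^ (K - n - 1 - j))⁻¹) ^ 2 * (((F.L : ℝ) ^ (1 + j))⁻¹) ^ a) :=
          mul_le_mul_of_nonneg_left (levelScale_le_T3 hL hb2 hab hj) h1
      _ = L_Φ * C_f * ((1 + dist K j Y c) * θBal F.L γ b₀ p₀ n * (((F.L : ℝ) ^ (K - n - 1 - j))⁻¹) ^ 2 * (((F.L : ℝ) ^ (1 + j))⁻¹) ^ a) := by ring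
      _ ≤ max C_N (L_Φ * C_f) * ((1 + dist K j Y c) * θBal F.L γ b₀ p₀ n * (((F.L : ℝ) ^ (K - n - 1 - j))⁻¹) ^ 2 * (((F.L : ℝ) ^ (1 + j))⁻¹) ^ a) :=
          mul_le_mul_of_nonneg_right (le_max_right _ _) hfac
      _ = _ := by ring
  · have hje : j + 1 = K - n := by omega
    calc _ ≤ C_N * (1 + dist K j Y c) * θBal F.L γ b₀ p₀ n * (((F.L : ℝ) ^ (K - n - 1 - j))⁻¹) ^ 2 * (((F.L : ℝ) ^ (1 + j))⁻¹) ^ a :=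
          hNew K n hnK j hj hje V hV Y hY c
      _ = C_N * ((1 + dist K j Y c) * θBal F.L γ b₀ p₀ n * (((F.L : ℝ) ^ (K - n - 1 - j))⁻¹) ^ 2 * (((F.L : ℝ) ^ (1 + j))⁻¹) ^ a) := by ring
      _ ≤ max C_N (L_Φ * C_f) * ((1 + dist K j Y c) * θBal F.L γ b₀ p₀ n * (((F.L : ℝ) ^ (K - n - 1 - j))⁻¹) ^ 2 * (((F.L : ℝ) ^ (1 + j))⁻¹) ^ a) :=
          mul_le_mul_of_nonneg_right (le_max_left _ _) hfac
      _ = _ := by ring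

end Split

section Natural

variable {𝔠 : AlphaConsts F.L (suGroupModel 2).N} {γ : ℝ} {hγ : 0 < γ} {hγ1 : γ ≤ (min 𝔠.gamma0 1) ^ 2}

/-- **(B) BELOW THE NEW LEVEL IS DEFINITIONAL** for the natural family with ANY anchor selector `sel`: off the new level (`b + 1 ≠ k`) `B♮ᶜ K k b Y W` is the chart-level map
`Φ♮ K k b Y` — «regime indicator · P_{𝔤ᶜ}(vec((27) of the `b`-fold ℰp-average at the anchor `sel K b Y`))» — applied to run `K`'s fine minimiser `(q K).UkH k triv W`.
[cite: Balaban1985UV3, (27) p.263, (43) p.266] -/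
theorem naturalCoherent_apply_of_ne (q : ∀ K, AlphaInputsT3AC.PkgCoreRows F 𝔠 γ hγ hγ1 K) (p₁ : ℝ)
    (sel : (K b : ℕ) → Set (Site (F.P K) 0) → Site (F.P K) b) {K k b : ℕ} (hbk : b + 1 ≠ k) (Y : Set (Site (F.P K) 0))
    (W : GaugeField (F.P K) k (Matrix.specialUnitaryGroup (Fin 2) ℂ)) (c : PBond (F.P K) b) :
    (fun K k b Y W c =>
        if h : b + 1 = k then birthCfgAtRows q K b Y (h ▸ W) c
        else if (l1 (rel (sel K b Y) c.src) : ℝ) * (2 * (𝔠.B₃ * θBal F.L γ 𝔠.b₀ p₁ (K - k)) * (((F.L : ℝ) ^ (k - b))⁻¹) ^ 2) ≤ 1 / 2 then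
          (lieC (suGroupModel 2)).orthogonalProjectionOnto (vecE (suGroupModel 2).N (B27T (unitsField (toUField
            (Averaging.iter (fun i => BlockAveraging.blockAvg (P := F.P K) (j := i) ℰp) b ((q K).UkH k (Hist.triv (F.P K) k) W)))) (sel K b Y) c))
        else 0) K k b Y W c =
      (fun K k b Y (U : GaugeField (F.P K) 0 (Matrix.specialUnitaryGroup (Fin 2) ℂ)) c =>
        if (l1 (rel (sel K b Y) c.src) : ℝ) * (2 * (𝔠.B₃ * θBal F.L γ 𝔠.b₀ p₁ (K - k)) * (((F.L : ℝ) ^ (k - b))⁻¹) ^ 2) ≤ 1 / 2 then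
          (lieC (suGroupModel 2)).orthogonalProjectionOnto (vecE (suGroupModel 2).N (B27T (unitsField (toUField
            (Averaging.iter (fun i => BlockAveraging.blockAvg (P := F.P K) (j := i) ℰp) b U))) (sel K b Y) c))
        else 0) K k b Y ((q K).UkH k (Hist.triv (F.P K) k) W) c := by
  simp only [dif_neg hbk]

/-- ★ **(B′) BELOW THE NEW LEVEL IS AN IDENTITY FOR A COHERENT ANCHOR**: if `sel (K+1) (j+1) (refineSet Y) = liftSite (sel K j Y)`, then run `K+1`'s natural configuration at lattice
level `K+1−n`, chart level `j+1` (`j + 1 < K − n`), the refined domain and the matched bond IS run `K`'s chart-level map `Φ♮ K (K−n) j Y` applied to run `K+1`'s fine minimiser averaged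
ONCE and read on run `K`'s finest lattice — same regime indicator (`l1_rel_liftSite_matchBond`), same loop variable (`B27T_iter_succ_liftSite_matchBond`). [cite: Balaban1985UV3, (27) p.263, (43) p.266; Balaban1987RG1, (0.1) p.251, (0.11) p.253] -/
theorem naturalCoherent_succ_apply_of_lt (q : ∀ K, AlphaInputsT3AC.PkgCoreRows F 𝔠 γ hγ hγ1 K) (p₁ : ℝ)
    (sel : (K b : ℕ) → Set (Site (F.P K) 0) → Site (F.P K) b) {K n j : ℕ} (hn : n ≤ K) (hj : j + 1 < K - n) (Y : Set (Site (F.P K) 0))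
    (hsel : sel (K + 1) (j + 1) (refineSet F K Y) = liftSite F K j (sel K j Y))
    (W' : GaugeField (F.P (K + 1)) (K + 1 - n) (Matrix.specialUnitaryGroup (Fin 2) ℂ)) (c : PBond (F.P K) j) :
    (fun K k b Y W c =>
        if h : b + 1 = k then birthCfgAtRows q K b Y (h ▸ W) c
        else if (l1 (rel (sel K b Y) c.src) : ℝ) * (2 * (𝔠.B₃ * θBal F.L γ 𝔠.b₀ p₁ (K - k)) * (((F.L : ℝ) ^ (k - b))⁻¹) ^ 2) ≤ 1 / 2 then
          (lieC (suGroupModel 2)).orthogonalProjectionOnto (vecE (suGroupModel 2).N (B27T (unitsField (toUField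
            (Averaging.iter (fun i => BlockAveraging.blockAvg (P := F.P K) (j := i) ℰp) b ((q K).UkH k (Hist.triv (F.P K) k) W)))) (sel K b Y) c))
        else 0) (K + 1) (K + 1 - n) (j + 1) (refineSet F K Y) W' (matchBond F K j c) =
      (fun K k b Y (U : GaugeField (F.P K) 0 (Matrix.specialUnitaryGroup (Fin 2) ℂ)) c =>
        if (l1 (rel (sel K b Y) c.src) : ℝ) * (2 * (𝔠.B₃ * θBal F.L γ 𝔠.b₀ p₁ (K - k)) * (((F.L : ℝ) ^ (k - b))⁻¹) ^ 2) ≤ 1 / 2 then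
          (lieC (suGroupModel 2)).orthogonalProjectionOnto (vecE (suGroupModel 2).N (B27T (unitsField (toUField
            (Averaging.iter (fun i => BlockAveraging.blockAvg (P := F.P K) (j := i) ℰp) b U))) (sel K b Y) c))
        else 0) K (K - n) j Y
        (fieldShift (F.sitesPerDir_eq (m := F.m) (K := K) (j := 0) (m' := F.m) (K' := K + 1) (j' := 1) (by omega))
          ((BlockAveraging.blockAvg (P := F.P (K + 1)) (j := 0) ℰp).avg ((q (K + 1)).UkH (K + 1 - n) (Hist.triv (F.P (K + 1)) (K + 1 - n)) W'))) c := by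
  have key := B27T_iter_succ_liftSite_matchBond K j ℰp ((q (K + 1)).UkH (K + 1 - n) (Hist.triv (F.P (K + 1)) (K + 1 - n)) W') (sel K j Y) c
  simp only [dif_neg (show ¬ (j + 1 + 1 = K + 1 - n) by omega)]
  rw [hsel, l1_rel_liftSite_matchBond, show K + 1 - (K + 1 - n) = K - (K - n) by omega, show K + 1 - n - (j + 1) = K - n - j by omega]
  exact congrArg (fun t => if (l1 (rel (sel K j Y) c.src) : ℝ) * (2 * (𝔠.B₃ * θBal F.L γ 𝔠.b₀ p₁ (K - (K - n))) * (((F.L : ℝ) ^ (K - n - j))⁻¹) ^ 2) ≤ 1 / 2 then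
    (lieC (suGroupModel 2)).orthogonalProjectionOnto (vecE (suGroupModel 2).N t) else 0) key

/-- ★★ **THE TWO-RUN ROW (BC) `CfgDistCauchyΦ` FOR THE NATURAL FAMILY WITH A RUN-COHERENT ANCHOR `sel` REDUCES TO THE NEW-LEVEL TWO-RUN ROW OF THE BIRTH CONFIGURATIONS PLUS A FINE
COMPARISON OF ORDER `b` AT THE OLD LEVELS** — (B) and (B′) of `cfgDistCauchyΦ_of_fineComparison_scale` DISCHARGED as identities below the new level (`naturalCoherent_apply_of_ne`,
`naturalCoherent_succ_apply_of_lt`).  Data: a rows record `q` (v4 χ-package: `q := fun K ↦ (p K).toRows`), a profile `p₁`, a selector `sel` with `sel (K+1) (b+1) (refineSet Y) =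
liftSite (sel K b Y)` (`exists_anchorSel_coherent`), ANY datum `D` and leg distance `dist`, a comparison `δ` of fine fields on run `K`'s finest lattice.  Displays: (New) the row's
inequality AT the new chart level `j + 1 = K − n` verbatim (there `B♮ᶜ` is the record's `Bcfg` on both runs: the pinned family's two-run coherence); (Lip♮) the chart-level map `Φ♮ K (K−n) j Y`
is legwise `L_Φ·(1 + d(c))·L^j`-Lipschitz in `δ` between run `K`'s fine minimiser `U_K = (q K).UkH (K−n) triv W` and run `K+1`'s once-averaged one `e₀(avg₀ ((q (K+1)).UkH (K+1−n) triv W′))`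
([Balaban1985Averaging] Prop. 6 (164) shape; met gauge-invariantly by `…KernelLegCfgFineScalesLocal` §4); (Fine_b) `δ(U_K, Ū_{K+1}) ≤ C_f·θ(n)·((L^{K−n})⁻¹)^b` (`2 ≤ b`, `a + 1 ≤ b`) — the
located-UNPRINTED two-cut-off consistency of the constrained minimisers (non-abelian d = 3).  Then `CfgDistCauchyΦ D B♮ᶜ dist 𝔠.b₀ p₁ a (max C_N (L_Φ·C_f))`.
[cite: Balaban1985UV3, (27) p.263, (43)-(44) pp.266-267; Balaban1985Averaging, Prop. 6 (164) p.43; King1986, Prop. 3.9 (3.73)-(3.74) p.665; Balaban1987RG1, (0.1) p.251, (0.11) p.253] -/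
theorem cfgDistCauchyΦ_naturalCoherent_of_newLevel_of_fine (q : ∀ K, AlphaInputsT3AC.PkgCoreRows F 𝔠 γ hγ hγ1 K) (p₁ : ℝ)
    (sel : (K b : ℕ) → Set (Site (F.P K) 0) → Site (F.P K) b)
    (hsel : ∀ (K b : ℕ) (Y : Set (Site (F.P K) 0)), sel (K + 1) (b + 1) (refineSet F K Y) = liftSite F K b (sel K b Y))
    {D : AlphaDataT3 F γ} {dist : LegDist F} {a b L_Φ C_f C_N : ℝ}
    (δ : (K k : ℕ) → GaugeField (F.P K) 0 (Matrix.specialUnitaryGroup (Fin 2) ℂ) → GaugeField (F.P K) 0 (Matrix.specialUnitaryGroup (Fin 2) ℂ) → ℝ)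
    (hn : DistNonneg dist) (hLΦ : 0 ≤ L_Φ) (hCf : 0 ≤ C_f) (hb2 : 2 ≤ b) (hab : a + 1 ≤ b)
    (hNew : ∀ (K n : ℕ) (h : n ≤ K), ∀ j : ℕ, j < K - n → j + 1 = K - n → ∀ V : GaugeField (F.P n) 0 (Matrix.specialUnitaryGroup (Fin 2) ℂ), PlaqSmall (θBal F.L γ 𝔠.b₀ p₁ n) V →
        ∀ Y ∈ D.Loc K (K - n) (D.triv K (K - n)) (1 + j), ∀ c : PBond (F.P K) j,
          ‖(fun K k b Y W c =>
        if h : b + 1 = k then birthCfgAtRows q K b Y (h ▸ W) c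
        else if (l1 (rel (sel K b Y) c.src) : ℝ) * (2 * (𝔠.B₃ * θBal F.L γ 𝔠.b₀ p₁ (K - k)) * (((F.L : ℝ) ^ (k - b))⁻¹) ^ 2) ≤ 1 / 2 then
          (lieC (suGroupModel 2)).orthogonalProjectionOnto (vecE (suGroupModel 2).N (B27T (unitsField (toUField
            (Averaging.iter (fun i => BlockAveraging.blockAvg (P := F.P K) (j := i) ℰp) b ((q K).UkH k (Hist.triv (F.P K) k) W)))) (sel K b Y) c))
        else 0) (K + 1) (K + 1 - n) (j + 1) (refineSet F K Y)
                (fieldShift (F.sitesPerDir_eq (m := F.m) (K := K + 1) (j := K + 1 - n) (m' := F.m) (K' := n) (j' := 0) (by omega)) V) (matchBond F K j c) -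
              (fun K k b Y W c =>
        if h : b + 1 = k then birthCfgAtRows q K b Y (h ▸ W) c
        else if (l1 (rel (sel K b Y) c.src) : ℝ) * (2 * (𝔠.B₃ * θBal F.L γ 𝔠.b₀ p₁ (K - k)) * (((F.L : ℝ) ^ (k - b))⁻¹) ^ 2) ≤ 1 / 2 then
          (lieC (suGroupModel 2)).orthogonalProjectionOnto (vecE (suGroupModel 2).N (B27T (unitsField (toUField
            (Averaging.iter (fun i => BlockAveraging.blockAvg (P := F.P K) (j := i) ℰp) b ((q K).UkH k (Hist.triv (F.P K) k) W)))) (sel K b Y) c))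
        else 0) K (K - n) j Y
                (fieldShift (F.sitesPerDir_eq (m := F.m) (K := K) (j := K - n) (m' := F.m) (K' := n) (j' := 0) (by omega)) V) c‖ ≤
            C_N * (1 + dist K j Y c) * θBal F.L γ 𝔠.b₀ p₁ n * (((F.L : ℝ) ^ (K - n - 1 - j))⁻¹) ^ 2 * (((F.L : ℝ) ^ (1 + j))⁻¹) ^ a)
    (hLip : ∀ (K n : ℕ) (h : n ≤ K), ∀ j : ℕ, j + 1 < K - n → ∀ V : GaugeField (F.P n) 0 (Matrix.specialUnitaryGroup (Fin 2) ℂ), PlaqSmall (θBal F.L γ 𝔠.b₀ p₁ n) V →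
        ∀ Y ∈ D.Loc K (K - n) (D.triv K (K - n)) (1 + j), ∀ c : PBond (F.P K) j,
          ‖(fun K k b Y (U : GaugeField (F.P K) 0 (Matrix.specialUnitaryGroup (Fin 2) ℂ)) c =>
        if (l1 (rel (sel K b Y) c.src) : ℝ) * (2 * (𝔠.B₃ * θBal F.L γ 𝔠.b₀ p₁ (K - k)) * (((F.L : ℝ) ^ (k - b))⁻¹) ^ 2) ≤ 1 / 2 then
          (lieC (suGroupModel 2)).orthogonalProjectionOnto (vecE (suGroupModel 2).N (B27T (unitsField (toUField
            (Averaging.iter (fun i => BlockAveraging.blockAvg (P := F.P K) (j := i) ℰp) b U))) (sel K b Y) c))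
        else 0) K (K - n) j Y ((q K).UkH (K - n) (Hist.triv (F.P K) (K - n)) (fieldShift (F.sitesPerDir_eq (m := F.m) (K := K) (j := K - n) (m' := F.m) (K' := n) (j' := 0) (by omega)) V)) c -
            (fun K k b Y (U : GaugeField (F.P K) 0 (Matrix.specialUnitaryGroup (Fin 2) ℂ)) c =>
        if (l1 (rel (sel K b Y) c.src) : ℝ) * (2 * (𝔠.B₃ * θBal F.L γ 𝔠.b₀ p₁ (K - k)) * (((F.L : ℝ) ^ (k - b))⁻¹) ^ 2) ≤ 1 / 2 then
          (lieC (suGroupModel 2)).orthogonalProjectionOnto (vecE (suGroupModel 2).N (B27T (unitsField (toUField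
            (Averaging.iter (fun i => BlockAveraging.blockAvg (P := F.P K) (j := i) ℰp) b U))) (sel K b Y) c))
        else 0) K (K - n) j Y
              (fieldShift (F.sitesPerDir_eq (m := F.m) (K := K) (j := 0) (m' := F.m) (K' := K + 1) (j' := 1) (by omega)) ((BlockAveraging.blockAvg (P := F.P (K + 1)) (j := 0) ℰp).avg
                ((q (K + 1)).UkH (K + 1 - n) (Hist.triv (F.P (K + 1)) (K + 1 - n)) (fieldShift (F.sitesPerDir_eq (m := F.m) (K := K + 1) (j := K + 1 - n) (m' := F.m) (K' := n) (j' := 0) (by omega)) V)))) c‖ ≤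
            L_Φ * (1 + dist K j Y c) * (F.L : ℝ) ^ j *
              δ K (K - n) ((q K).UkH (K - n) (Hist.triv (F.P K) (K - n)) (fieldShift (F.sitesPerDir_eq (m := F.m) (K := K) (j := K - n) (m' := F.m) (K' := n) (j' := 0) (by omega)) V))
                (fieldShift (F.sitesPerDir_eq (m := F.m) (K := K) (j := 0) (m' := F.m) (K' := K + 1) (j' := 1) (by omega)) ((BlockAveraging.blockAvg (P := F.P (K + 1)) (j := 0) ℰp).avg
                ((q (K + 1)).UkH (K + 1 - n) (Hist.triv (F.P (K + 1)) (K + 1 - n)) (fieldShift (F.sitesPerDir_eq (m := F.m) (K := K + 1) (j := K + 1 - n) (m' := F.m) (K' := n) (j' := 0) (by omega)) V)))))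
    (hFine : ∀ (K n : ℕ) (h : n ≤ K), 1 < K - n → ∀ V : GaugeField (F.P n) 0 (Matrix.specialUnitaryGroup (Fin 2) ℂ), PlaqSmall (θBal F.L γ 𝔠.b₀ p₁ n) V →
        δ K (K - n) ((q K).UkH (K - n) (Hist.triv (F.P K) (K - n)) (fieldShift (F.sitesPerDir_eq (m := F.m) (K := K) (j := K - n) (m' := F.m) (K' := n) (j' := 0) (by omega)) V))
            (fieldShift (F.sitesPerDir_eq (m := F.m) (K := K) (j := 0) (m' := F.m) (K' := K + 1) (j' := 1) (by omega)) ((BlockAveraging.blockAvg (P := F.P (K + 1)) (j := 0) ℰp).avg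
                ((q (K + 1)).UkH (K + 1 - n) (Hist.triv (F.P (K + 1)) (K + 1 - n)) (fieldShift (F.sitesPerDir_eq (m := F.m) (K := K + 1) (j := K + 1 - n) (m' := F.m) (K' := n) (j' := 0) (by omega)) V)))) ≤
          C_f * θBal F.L γ 𝔠.b₀ p₁ n * (((F.L : ℝ) ^ (K - n))⁻¹) ^ b) :
    CfgDistCauchyΦ D
      (fun K k b Y W c =>
        if h : b + 1 = k then birthCfgAtRows q K b Y (h ▸ W) c
        else if (l1 (rel (sel K b Y) c.src) : ℝ) * (2 * (𝔠.B₃ * θBal F.L γ 𝔠.b₀ p₁ (K - k)) * (((F.L : ℝ) ^ (k - b))⁻¹) ^ 2) ≤ 1 / 2 then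
          (lieC (suGroupModel 2)).orthogonalProjectionOnto (vecE (suGroupModel 2).N (B27T (unitsField (toUField
            (Averaging.iter (fun i => BlockAveraging.blockAvg (P := F.P K) (j := i) ℰp) b ((q K).UkH k (Hist.triv (F.P K) k) W)))) (sel K b Y) c))
        else 0)
      dist 𝔠.b₀ p₁ a (max C_N (L_Φ * C_f)) := by
  have hγ1' : γ ≤ 1 := hγ1.trans (sq_min_one_le _ 𝔠.gamma0_pos)
  refine cfgDistCauchyΦ_of_fineComparison_scale_split (fun K => GaugeField (F.P K) 0 (Matrix.specialUnitaryGroup (Fin 2) ℂ))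
    (fun K k W => (q K).UkH k (Hist.triv (F.P K) k) W)
    (fun K k k' W' => fieldShift (F.sitesPerDir_eq (m := F.m) (K := K) (j := 0) (m' := F.m) (K' := K + 1) (j' := 1) (by omega))
      ((BlockAveraging.blockAvg (P := F.P (K + 1)) (j := 0) ℰp).avg ((q (K + 1)).UkH k' (Hist.triv (F.P (K + 1)) k') W')))
    (fun K k b Y (U : GaugeField (F.P K) 0 (Matrix.specialUnitaryGroup (Fin 2) ℂ)) c =>
        if (l1 (rel (sel K b Y) c.src) : ℝ) * (2 * (𝔠.B₃ * θBal F.L γ 𝔠.b₀ p₁ (K - k)) * (((F.L : ℝ) ^ (k - b))⁻¹) ^ 2) ≤ 1 / 2 then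
          (lieC (suGroupModel 2)).orthogonalProjectionOnto (vecE (suGroupModel 2).N (B27T (unitsField (toUField
            (Averaging.iter (fun i => BlockAveraging.blockAvg (P := F.P K) (j := i) ℰp) b U))) (sel K b Y) c))
        else 0)
    δ hn F.hL.2.le hγ hγ1' 𝔠.b₀_pos hLΦ hCf hb2 hab hNew ?_ ?_ hLip hFine
  · intro K n hnK j hjo V _ Y _
    funext c
    exact naturalCoherent_apply_of_ne q p₁ sel (by omega) Y _ c
  · intro K n hnK j hjo V _ Y _ c
    exact naturalCoherent_succ_apply_of_lt q p₁ sel hnK hjo Y (hsel K j Y) _ c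

end Natural

end Summit.QuantumFields.YangMills.Theorems.GlobalSlackKernelLeg
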